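import Mathlib.Analysis.Calculus.ContDiff.Basic
import Mathlib.Analysis.Normed.Operator.BoundedLinearMaps
import Literature.Geometry.ComplexHyperbolic.UnitBallSheetIntegralBounds   -- ★ `‖W‖^{−k} ∈ L¹_loc(ℝ⁴)`, `{nsq ≤ M}` compact, `W ≠ 0` a.e., `‖W‖ ≤ √(ε+nsq W)`
import HarnessLib

/-!
# Time-dependent sheet data `Λ(t, W, r)` over the sheets `Q = −ε(t)`: majorants uniform in `t` (ROAD A ENGINE-T, part 1)

Topic `Geometry/ComplexHyperbolic`; namespace `Literature.Geometry.ComplexHyperbolic.BallModel`.  THEOREMS ONLY (no `def`, no instance, no notation, no axiom,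
no named fact, no `sorry`).  Cell `pub/hodgecm-mathlib`, ENGINE T1 (crux H413 = `stmt-HodgeConjecture-24833`); floor-1½, count-neutral, under row (S-d) ∕ «SdArch» ED. 3 node N1
(`stub_ArchCentralLimitU21`): the time-dependent generalisation of ★ `UnitBallSheetIntegralBounds` ∕ ★ `UnitBallSheetIntegralDeriv`, cut to deliver the hypothesis
`hψ : ContDiffOn ℝ 2 ψ (Icc 0 δ)`, `ψ(t) = m(t)·Φ_Θ(k_t)`, of ★ p06 `ArchCentralLimitCompactWallValue.quarter_sub_eq_of_wallGerms` ((A4)-V); author F0P3a-p05 (g13), 2026-09-01.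

WHY TIME-DEPENDENCE.  Along the wall curve `k_t = ζ·(e^{it}, e^{it}, e^{−2it})` of ★ (A4)-T∕(A4)-V the `ε²`-normalised `K`-central orbital integral is (★ packaging p843337)
`m(t)·Φ_Θ(k_t) = c_μ·∫_{ℂ²} Θ(ζe^{it}•1 + iζe^{−it∕2}•N(W, √(ε(t)+|W|²))) d⁴W`, `ε(t) = 2 sin(3t∕2) = |v_t − u_t|`: the test datum depends on `t` (through `u_t, η_t`) AND the
sheet radius is `ε(t)`.  So the datum is now `Λ : ℝ × ℂ² × ℝ → G`, `(t, W, r) ↦ Λ(t, W, r)`, of class `C²` JOINTLY (for `Θ ∈ C²` composed with the polynomial sheet map) with an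
`r²`-SUPPORT BOUND `Λ(t, W, r) = 0` for `r² ≥ S` (all `t`), and the integral is `I(t) = ∫ Λ(t, W, √(ε(t) + |W|²)) d⁴W` for a `C²` sheet radius `ε ≥ 0` (data `ε, ε₁ = ε′, ε₂ = ε″`).
Along `γ(t) = (t, W, ρ)`, `ρ = √(ε(t)+|W|²)`: `γ′ = (1, 0, ε₁(2ρ)⁻¹)`, `γ″ = (0, 0, ε₂(2ρ)⁻¹ − ε₁²(4ρ³)⁻¹)`, and
  `∂_t Λ(γ) = DΛ(γ)[γ′]`,   `∂_t² Λ(γ) = D²Λ(γ)[γ′, γ′] + DΛ(γ)[γ″]`.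
THIS FILE: the three MAJORANTS, UNIFORM IN `t ∈ [0, T]`: `‖Λ(γ)‖ ≤ C·𝟙`, `‖DΛ(γ)[γ′]‖ ≤ B‖W‖⁻¹·𝟙`, `‖D²Λ(γ)[γ′,γ′] + DΛ(γ)[γ″]‖ ≤ D‖W‖⁻³·𝟙` (`𝟙 = 𝟙{nsq ≤ S}`, `W ≠ 0`),
from: `DΛ = D²Λ = 0` past the support (locally zero function), operator-norm bounds of `DΛ`, `D²Λ` on the compact `[0,T] × {nsq ≤ S} × [0, √S]`, bounds of `ε₁, ε₂` on `[0,T]`,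
`‖γ′‖ ≤ 1 + |ε₁|(2ρ)⁻¹`, `‖γ″‖ ≤ |ε₂|(2ρ)⁻¹ + ε₁²(4ρ³)⁻¹`, `‖W‖ ≤ ρ`, and on the support `‖W‖^{−j} ≤ (√S)^{3−j}‖W‖⁻³`.  Part 2 (★-to-be `UnitBallSheetFamilyDeriv`) differentiates under `∫`.
GOTCHA kept: `have h1 := hΛ.fderiv_right (m := 1) le_rfl` UNASCRIBED (the space `E →L (E →L G)` produced by `fderiv` carries the strong topology; never re-synthesise its norm).

* §1 `fderiv_eq_zero_of_lt_sq`, `fderiv_fderiv_eq_zero_of_lt_sq`; §2 `norm_one_zero_mk_le`, `norm_zero_zero_mk_le`, `pow_inv_le_of_norm_le_sqrt`;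
* §3 **`exists_bound_family_zero ∕ one ∕ two`**; §4 `hasDerivAt_sqrt_eps_add_nsq`, `hasDerivAt_curve`, `hasDerivAt_velocity`, **`hasDerivAt_comp_curve`** (`∂_tΛ(γ) = DΛ(γ)[γ′]`),
  **`hasDerivAt_fderiv_comp_curve`** (`∂_t DΛ(γ)[γ′] = D²Λ(γ)[γ′,γ′] + DΛ(γ)[γ″]`).
HONEST LABEL: HC_CM is proved only modulo the printed citations until rung 0 closes; this file is real analysis over ★ ball-model files and pays nothing by itself.

## References
* [Rogawski1990] J. D. Rogawski, *Automorphic Representations of Unitary Groups in Three Variables*, Ann. of Math. Stud. 123 (1990), §8.4 pp. 126–127.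
* [Rudin1980] W. Rudin, *Function Theory in the Unit Ball of ℂⁿ* (1980), §1.4 (integration on `ℂⁿ`; local integrability of `|z|^{−k}`).
-/

noncomputable section

open MeasureTheory MeasureTheory.Measure Set Filter Topology Metric
open scoped ENNReal

namespace Literature.Geometry.ComplexHyperbolic.BallModel

section EngineT

variable {G : Type*} [NormedAddCommGroup G] [NormedSpace ℝ G] {Λ : ℝ × (Fin 2 → ℂ) × ℝ → G} {S T : ℝ} {ε ε₁ ε₂ : ℝ → ℝ}

/-! ### §1 Support: the datum and its first two Fréchet derivatives vanish past the `r²`-support bound -/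

/-- `fderiv Λ` vanishes past the support: `S < r²` ⇒ `DΛ(t, W, r) = 0`. [cite: Rudin1980, §1.4] -/
theorem fderiv_eq_zero_of_lt_sq (hS : ∀ (t : ℝ) (W : Fin 2 → ℂ) (r : ℝ), S ≤ r ^ 2 → Λ (t, W, r) = 0)
    (t : ℝ) (W : Fin 2 → ℂ) {r : ℝ} (hr : S < r ^ 2) : fderiv ℝ Λ (t, W, r) = 0 := by
  have hopen : IsOpen {p : ℝ × (Fin 2 → ℂ) × ℝ | S < p.2.2 ^ 2} :=
    isOpen_lt continuous_const ((continuous_snd.comp continuous_snd).pow 2)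
  have hev : Λ =ᶠ[𝓝 (t, W, r)] fun _ => (0 : G) := by
    filter_upwards [hopen.mem_nhds (show (t, W, r) ∈ {p : ℝ × (Fin 2 → ℂ) × ℝ | S < p.2.2 ^ 2} from hr)] with p hp
    exact hS p.1 p.2.1 p.2.2 (le_of_lt hp)
  rw [hev.fderiv_eq, fderiv_const_apply]

/-- `fderiv (fderiv Λ)` vanishes past the support. [cite: Rudin1980, §1.4] -/
theorem fderiv_fderiv_eq_zero_of_lt_sq (hS : ∀ (t : ℝ) (W : Fin 2 → ℂ) (r : ℝ), S ≤ r ^ 2 → Λ (t, W, r) = 0)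
    (t : ℝ) (W : Fin 2 → ℂ) {r : ℝ} (hr : S < r ^ 2) : fderiv ℝ (fderiv ℝ Λ) (t, W, r) = 0 := by
  have hopen : IsOpen {p : ℝ × (Fin 2 → ℂ) × ℝ | S < p.2.2 ^ 2} :=
    isOpen_lt continuous_const ((continuous_snd.comp continuous_snd).pow 2)
  have hev : fderiv ℝ Λ =ᶠ[𝓝 (t, W, r)] fun _ => (0 : ℝ × (Fin 2 → ℂ) × ℝ →L[ℝ] G) := by
    filter_upwards [hopen.mem_nhds (show (t, W, r) ∈ {p : ℝ × (Fin 2 → ℂ) × ℝ | S < p.2.2 ^ 2} from hr)] with p hp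
    exact fderiv_eq_zero_of_lt_sq hS p.1 p.2.1 hp
  rw [hev.fderiv_eq, fderiv_const_apply]

/-! ### §2 The tangent data of the curve `t ↦ (t, W, √(ε(t)+|W|²))` and their size -/

/-- The sup norm of the velocity `(1, 0, x)` is at most `1 + |x|`. [cite: Rudin1980, §1.4] -/
theorem norm_one_zero_mk_le (x : ℝ) : ‖((1 : ℝ), (0 : Fin 2 → ℂ), x)‖ ≤ 1 + |x| := by
  rw [Prod.norm_def, Prod.norm_def]
  simp only [norm_one, norm_zero, Real.norm_eq_abs]
  refine max_le (by linarith [abs_nonneg x]) (max_le (by linarith [abs_nonneg x]) (by linarith))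

/-- The sup norm of the acceleration `(0, 0, x)` is `|x|`. [cite: Rudin1980, §1.4] -/
theorem norm_zero_zero_mk_le (x : ℝ) : ‖((0 : ℝ), (0 : Fin 2 → ℂ), x)‖ ≤ |x| := by
  rw [Prod.norm_def, Prod.norm_def]
  simp only [norm_zero, Real.norm_eq_abs]
  exact max_le (abs_nonneg x) (max_le (abs_nonneg x) le_rfl)

/-- On the support (`‖W‖ ≤ ρ ≤ √S`, `W ≠ 0`): `1 ≤ √S·‖W‖⁻¹`, `‖W‖⁻¹ ≤ S·‖W‖⁻³`... the comparison `‖W‖^{-j} ≤ (√S)^{3−j}·‖W‖⁻³` for `j = 0, 1, 2`.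
[cite: Rudin1980, §1.4] -/
theorem pow_inv_le_of_norm_le_sqrt {W : Fin 2 → ℂ} (hW : W ≠ 0) {S : ℝ} (hWS : ‖W‖ ≤ Real.sqrt S) :
    1 ≤ Real.sqrt S ^ 3 * (‖W‖ ^ 3)⁻¹ ∧ ‖W‖⁻¹ ≤ Real.sqrt S ^ 2 * (‖W‖ ^ 3)⁻¹ ∧ (‖W‖ ^ 2)⁻¹ ≤ Real.sqrt S * (‖W‖ ^ 3)⁻¹ := by
  have hn : 0 < ‖W‖ := norm_pos_iff.2 hW
  have h3 : 0 < ‖W‖ ^ 3 := by positivity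
  refine ⟨?_, ?_, ?_⟩
  · rw [le_mul_inv_iff₀ h3, one_mul]
    exact pow_le_pow_left₀ hn.le hWS 3
  · rw [le_mul_inv_iff₀ h3]
    calc ‖W‖⁻¹ * ‖W‖ ^ 3 = ‖W‖ ^ 2 := by field_simp
      _ ≤ Real.sqrt S ^ 2 := pow_le_pow_left₀ hn.le hWS 2
  · rw [le_mul_inv_iff₀ h3]
    calc (‖W‖ ^ 2)⁻¹ * ‖W‖ ^ 3 = ‖W‖ := by field_simp
      _ ≤ Real.sqrt S := hWS
      _ = Real.sqrt S := rfl

/-! ### §3 Uniform majorants for the time-dependent sheet data on `t ∈ [0, T]`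

Hypotheses: `Λ` of class `C²` on `ℝ × ℂ² × ℝ` with `r²`-support bound `S`; `ε, ε₁, ε₂` continuous on `[0,T]` (sheet radius and its first two derivatives as DATA),
`ε ≥ 0` on `[0,T]`.  The three integrands: `Λ(γ)`, `DΛ(γ)[γ′]`, `D²Λ(γ)[γ′,γ′] + DΛ(γ)[γ″]` with `γ = (t, W, ρ)`, `ρ = √(ε(t)+|W|²)`,
`γ′ = (1, 0, ε₁(t)(2ρ)⁻¹)`, `γ″ = (0, 0, ε₂(t)(2ρ)⁻¹ − ε₁(t)²(4ρ³)⁻¹)`. -/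

omit [NormedSpace ℝ G] in
/-- UNIFORM BOUND, ORDER 0: `‖Λ(t, W, √(ε(t)+|W|²))‖ ≤ C·𝟙{nsq ≤ S}(W)` for `t ∈ [0,T]` (`ε(t) ≥ 0`). [cite: Rudin1980, §1.4] -/
theorem exists_bound_family_zero (hΛ : Continuous Λ) (hS : ∀ (t : ℝ) (W : Fin 2 → ℂ) (r : ℝ), S ≤ r ^ 2 → Λ (t, W, r) = 0)
    (hε0 : ∀ t ∈ Icc (0 : ℝ) T, 0 ≤ ε t) :
    ∃ C : ℝ, 0 ≤ C ∧ ∀ t ∈ Icc (0 : ℝ) T, ∀ W : Fin 2 → ℂ,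
      ‖Λ (t, W, Real.sqrt (ε t + nsq W))‖ ≤ ({W : Fin 2 → ℂ | nsq W ≤ S}).indicator (fun _ => C) W := by
  obtain ⟨C, hC⟩ := ((isCompact_Icc (a := (0 : ℝ)) (b := T)).prod ((isCompact_setOf_nsq_le_ambient S).prod
    (isCompact_Icc (a := (0 : ℝ)) (b := Real.sqrt S)))).exists_bound_of_continuousOn hΛ.norm.continuousOn
  refine ⟨max C 0, le_max_right _ _, fun t ht W => ?_⟩
  have hεt := hε0 t ht
  by_cases hW : W ∈ {W : Fin 2 → ℂ | nsq W ≤ S}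
  · rw [indicator_of_mem hW]
    by_cases hr : S < Real.sqrt (ε t + nsq W) ^ 2
    · rw [hS t W _ hr.le, norm_zero]
      exact le_max_right _ _
    · have hmem : (t, W, Real.sqrt (ε t + nsq W)) ∈ Icc (0 : ℝ) T ×ˢ ({W : Fin 2 → ℂ | nsq W ≤ S} ×ˢ Icc (0 : ℝ) (Real.sqrt S)) :=
        ⟨ht, hW, Real.sqrt_nonneg _, Real.le_sqrt_of_sq_le (not_lt.1 hr)⟩
      have h := hC _ hmem
      rw [norm_norm] at h
      exact h.trans (le_max_left _ _)
  · rw [indicator_of_notMem hW]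
    simp only [mem_setOf_eq, not_le] at hW
    have hr : S ≤ Real.sqrt (ε t + nsq W) ^ 2 := by
      rw [Real.sq_sqrt (by linarith [nsq_nonneg W])]
      linarith
    rw [hS t W _ hr, norm_zero]

/-- UNIFORM BOUND, ORDER 1: `‖DΛ(γ)[γ′]‖ ≤ B·‖W‖⁻¹·𝟙{nsq ≤ S}(W)` for `t ∈ [0,T]`, `W ≠ 0`. [cite: Rudin1980, §1.4] -/
theorem exists_bound_family_one (hΛ : ContDiff ℝ 2 Λ) (hS : ∀ (t : ℝ) (W : Fin 2 → ℂ) (r : ℝ), S ≤ r ^ 2 → Λ (t, W, r) = 0)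
    (hε0 : ∀ t ∈ Icc (0 : ℝ) T, 0 ≤ ε t) (hε₁ : ContinuousOn ε₁ (Icc 0 T)) :
    ∃ B : ℝ, 0 ≤ B ∧ ∀ t ∈ Icc (0 : ℝ) T, ∀ W : Fin 2 → ℂ, W ≠ 0 →
      ‖(fderiv ℝ Λ (t, W, Real.sqrt (ε t + nsq W))) ((1 : ℝ), (0 : Fin 2 → ℂ), ε₁ t * (2 * Real.sqrt (ε t + nsq W))⁻¹)‖ ≤
        ({W : Fin 2 → ℂ | nsq W ≤ S}).indicator (fun W => B * ‖W‖ ^ (-(1 : ℝ))) W := by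
  obtain ⟨C, hC⟩ := ((isCompact_Icc (a := (0 : ℝ)) (b := T)).prod ((isCompact_setOf_nsq_le_ambient S).prod
    (isCompact_Icc (a := (0 : ℝ)) (b := Real.sqrt S)))).exists_bound_of_continuousOn (hΛ.continuous_fderiv two_ne_zero).norm.continuousOn
  obtain ⟨M, hM⟩ := (isCompact_Icc (a := (0 : ℝ)) (b := T)).exists_bound_of_continuousOn hε₁
  set C' := max C 0 with hC'
  set M' := max M 0 with hM'
  refine ⟨C' * (Real.sqrt S + M' / 2), by positivity, fun t ht W hW0 => ?_⟩
  have hεt := hε0 t ht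
  have hn : 0 < ‖W‖ := norm_pos_iff.2 hW0
  have hρ : ‖W‖ ≤ Real.sqrt (ε t + nsq W) := norm_le_sqrt_add_nsq W hεt
  have hρ0 : 0 < Real.sqrt (ε t + nsq W) := hn.trans_le hρ
  have hMt : |ε₁ t| ≤ M' := by have h := hM t ht; rw [Real.norm_eq_abs] at h; exact h.trans (le_max_left _ _)
  by_cases hW : W ∈ {W : Fin 2 → ℂ | nsq W ≤ S}
  · have hWS : ‖W‖ ≤ Real.sqrt S := (norm_le_sqrt_nsq W).trans (Real.sqrt_le_sqrt hW)
    rw [indicator_of_mem hW, Real.rpow_neg (norm_nonneg _), Real.rpow_one]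
    by_cases hr : S < Real.sqrt (ε t + nsq W) ^ 2
    · rw [fderiv_eq_zero_of_lt_sq hS t W hr, _root_.zero_apply, norm_zero]
      positivity
    · have hmem : (t, W, Real.sqrt (ε t + nsq W)) ∈ Icc (0 : ℝ) T ×ˢ ({W : Fin 2 → ℂ | nsq W ≤ S} ×ˢ Icc (0 : ℝ) (Real.sqrt S)) :=
        ⟨ht, hW, Real.sqrt_nonneg _, Real.le_sqrt_of_sq_le (not_lt.1 hr)⟩
      have hop : ‖fderiv ℝ Λ (t, W, Real.sqrt (ε t + nsq W))‖ ≤ C' := by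
        have h := hC _ hmem; rw [norm_norm] at h; exact h.trans (le_max_left _ _)
      have hv : ‖((1 : ℝ), (0 : Fin 2 → ℂ), ε₁ t * (2 * Real.sqrt (ε t + nsq W))⁻¹)‖ ≤ 1 + M' / 2 * ‖W‖⁻¹ := by
        refine (norm_one_zero_mk_le _).trans ?_
        rw [abs_mul, abs_inv, abs_of_pos (by positivity : (0 : ℝ) < 2 * Real.sqrt (ε t + nsq W))]
        have : |ε₁ t| * (2 * Real.sqrt (ε t + nsq W))⁻¹ ≤ M' * (2 * ‖W‖)⁻¹ := by
          gcongr
        calc 1 + |ε₁ t| * (2 * Real.sqrt (ε t + nsq W))⁻¹ ≤ 1 + M' * (2 * ‖W‖)⁻¹ := by linarith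
          _ = 1 + M' / 2 * ‖W‖⁻¹ := by field_simp
      calc ‖(fderiv ℝ Λ (t, W, Real.sqrt (ε t + nsq W))) ((1 : ℝ), (0 : Fin 2 → ℂ), ε₁ t * (2 * Real.sqrt (ε t + nsq W))⁻¹)‖
          ≤ C' * (1 + M' / 2 * ‖W‖⁻¹) := (ContinuousLinearMap.le_opNorm _ _).trans (by gcongr)
        _ ≤ C' * (Real.sqrt S * ‖W‖⁻¹ + M' / 2 * ‖W‖⁻¹) := by
            gcongr
            rw [le_mul_inv_iff₀ hn, one_mul]
            exact hWS
        _ = C' * (Real.sqrt S + M' / 2) * ‖W‖⁻¹ := by ring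
  · rw [indicator_of_notMem hW]
    simp only [mem_setOf_eq, not_le] at hW
    have hr : S < Real.sqrt (ε t + nsq W) ^ 2 := by
      rw [Real.sq_sqrt (by linarith [nsq_nonneg W])]
      linarith
    rw [fderiv_eq_zero_of_lt_sq hS t W hr, _root_.zero_apply, norm_zero]

/-- UNIFORM BOUND, ORDER 2: `‖D²Λ(γ)[γ′,γ′] + DΛ(γ)[γ″]‖ ≤ D·‖W‖⁻³·𝟙{nsq ≤ S}(W)` for `t ∈ [0,T]`, `W ≠ 0`. [cite: Rudin1980, §1.4] -/
theorem exists_bound_family_two (hΛ : ContDiff ℝ 2 Λ) (hS : ∀ (t : ℝ) (W : Fin 2 → ℂ) (r : ℝ), S ≤ r ^ 2 → Λ (t, W, r) = 0)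
    (hε0 : ∀ t ∈ Icc (0 : ℝ) T, 0 ≤ ε t) (hε₁ : ContinuousOn ε₁ (Icc 0 T)) (hε₂ : ContinuousOn ε₂ (Icc 0 T)) :
    ∃ D : ℝ, 0 ≤ D ∧ ∀ t ∈ Icc (0 : ℝ) T, ∀ W : Fin 2 → ℂ, W ≠ 0 →
      ‖(fderiv ℝ (fderiv ℝ Λ) (t, W, Real.sqrt (ε t + nsq W)) ((1 : ℝ), (0 : Fin 2 → ℂ), ε₁ t * (2 * Real.sqrt (ε t + nsq W))⁻¹))
          ((1 : ℝ), (0 : Fin 2 → ℂ), ε₁ t * (2 * Real.sqrt (ε t + nsq W))⁻¹) +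
        (fderiv ℝ Λ (t, W, Real.sqrt (ε t + nsq W)))
          ((0 : ℝ), (0 : Fin 2 → ℂ), ε₂ t * (2 * Real.sqrt (ε t + nsq W))⁻¹ - ε₁ t ^ 2 * (4 * Real.sqrt (ε t + nsq W) ^ 3)⁻¹)‖ ≤
        ({W : Fin 2 → ℂ | nsq W ≤ S}).indicator (fun W => D * ‖W‖ ^ (-(3 : ℝ))) W := by
  -- NB: `h1` unascribed (keeps the norm-derived topology on the space of continuous linear maps)
  have h1 := hΛ.fderiv_right (m := 1) le_rfl
  obtain ⟨C₁, hC₁⟩ := ((isCompact_Icc (a := (0 : ℝ)) (b := T)).prod ((isCompact_setOf_nsq_le_ambient S).prod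
    (isCompact_Icc (a := (0 : ℝ)) (b := Real.sqrt S)))).exists_bound_of_continuousOn (hΛ.continuous_fderiv two_ne_zero).norm.continuousOn
  obtain ⟨C₂, hC₂⟩ := ((isCompact_Icc (a := (0 : ℝ)) (b := T)).prod ((isCompact_setOf_nsq_le_ambient S).prod
    (isCompact_Icc (a := (0 : ℝ)) (b := Real.sqrt S)))).exists_bound_of_continuousOn (h1.continuous_fderiv one_ne_zero).norm.continuousOn
  obtain ⟨M₁, hM₁⟩ := (isCompact_Icc (a := (0 : ℝ)) (b := T)).exists_bound_of_continuousOn hε₁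
  obtain ⟨M₂, hM₂⟩ := (isCompact_Icc (a := (0 : ℝ)) (b := T)).exists_bound_of_continuousOn hε₂
  set A := max C₂ 0 with hA
  set B := max C₁ 0 with hB
  set P := max M₁ 0 with hP
  set Q := max M₂ 0 with hQ
  -- the constant: every term is dominated by `const · ‖W‖⁻³` on the support `‖W‖ ≤ √S`
  refine ⟨A * (Real.sqrt S ^ 3 + P * Real.sqrt S ^ 2 + P ^ 2 / 4 * Real.sqrt S) + B * (Q / 2 * Real.sqrt S ^ 2 + P ^ 2 / 4), by positivity,
    fun t ht W hW0 => ?_⟩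
  have hεt := hε0 t ht
  have hn : 0 < ‖W‖ := norm_pos_iff.2 hW0
  have hρ : ‖W‖ ≤ Real.sqrt (ε t + nsq W) := norm_le_sqrt_add_nsq W hεt
  have hρ0 : 0 < Real.sqrt (ε t + nsq W) := hn.trans_le hρ
  have hP1 : |ε₁ t| ≤ P := by have h := hM₁ t ht; rw [Real.norm_eq_abs] at h; exact h.trans (le_max_left _ _)
  have hQ2 : |ε₂ t| ≤ Q := by have h := hM₂ t ht; rw [Real.norm_eq_abs] at h; exact h.trans (le_max_left _ _)
  by_cases hW : W ∈ {W : Fin 2 → ℂ | nsq W ≤ S}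
  · have hWS : ‖W‖ ≤ Real.sqrt S := (norm_le_sqrt_nsq W).trans (Real.sqrt_le_sqrt hW)
    obtain ⟨k0, k1, k2⟩ := pow_inv_le_of_norm_le_sqrt hW0 hWS
    rw [indicator_of_mem hW, Real.rpow_neg (norm_nonneg _), show (3 : ℝ) = ((3 : ℕ) : ℝ) by norm_num, Real.rpow_natCast]
    by_cases hr : S < Real.sqrt (ε t + nsq W) ^ 2
    · rw [fderiv_eq_zero_of_lt_sq hS t W hr, fderiv_fderiv_eq_zero_of_lt_sq hS t W hr, _root_.zero_apply,
        _root_.zero_apply, _root_.zero_apply, add_zero, norm_zero]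
      positivity
    · have hmem : (t, W, Real.sqrt (ε t + nsq W)) ∈ Icc (0 : ℝ) T ×ˢ ({W : Fin 2 → ℂ | nsq W ≤ S} ×ˢ Icc (0 : ℝ) (Real.sqrt S)) :=
        ⟨ht, hW, Real.sqrt_nonneg _, Real.le_sqrt_of_sq_le (not_lt.1 hr)⟩
      have hop1 : ‖fderiv ℝ Λ (t, W, Real.sqrt (ε t + nsq W))‖ ≤ B := by
        have h := hC₁ _ hmem; rw [norm_norm] at h; exact h.trans (le_max_left _ _)
      have hop2 : ‖fderiv ℝ (fderiv ℝ Λ) (t, W, Real.sqrt (ε t + nsq W))‖ ≤ A := by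
        have h := hC₂ _ hmem; rw [norm_norm] at h; exact h.trans (le_max_left _ _)
      set ρ := Real.sqrt (ε t + nsq W) with hρdef
      -- sizes of the tangent data
      have hv : ‖((1 : ℝ), (0 : Fin 2 → ℂ), ε₁ t * (2 * ρ)⁻¹)‖ ≤ 1 + P / 2 * ‖W‖⁻¹ := by
        refine (norm_one_zero_mk_le _).trans ?_
        rw [abs_mul, abs_inv, abs_of_pos (by positivity : (0 : ℝ) < 2 * ρ)]
        have : |ε₁ t| * (2 * ρ)⁻¹ ≤ P * (2 * ‖W‖)⁻¹ := by gcongr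
        calc 1 + |ε₁ t| * (2 * ρ)⁻¹ ≤ 1 + P * (2 * ‖W‖)⁻¹ := by linarith
          _ = 1 + P / 2 * ‖W‖⁻¹ := by field_simp
      have hacc : ‖((0 : ℝ), (0 : Fin 2 → ℂ), ε₂ t * (2 * ρ)⁻¹ - ε₁ t ^ 2 * (4 * ρ ^ 3)⁻¹)‖ ≤ Q / 2 * ‖W‖⁻¹ + P ^ 2 / 4 * (‖W‖ ^ 3)⁻¹ := by
        refine (norm_zero_zero_mk_le _).trans ((abs_sub _ _).trans ?_)
        rw [abs_mul, abs_mul, abs_inv, abs_inv, abs_of_pos (by positivity : (0 : ℝ) < 2 * ρ), abs_of_pos (by positivity : (0 : ℝ) < 4 * ρ ^ 3),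
          abs_pow]
        have h1' : |ε₂ t| * (2 * ρ)⁻¹ ≤ Q * (2 * ‖W‖)⁻¹ := by gcongr
        have h2' : |ε₁ t| ^ 2 * (4 * ρ ^ 3)⁻¹ ≤ P ^ 2 * (4 * ‖W‖ ^ 3)⁻¹ := by gcongr
        calc |ε₂ t| * (2 * ρ)⁻¹ + |ε₁ t| ^ 2 * (4 * ρ ^ 3)⁻¹ ≤ Q * (2 * ‖W‖)⁻¹ + P ^ 2 * (4 * ‖W‖ ^ 3)⁻¹ := add_le_add h1' h2'
          _ = Q / 2 * ‖W‖⁻¹ + P ^ 2 / 4 * (‖W‖ ^ 3)⁻¹ := by field_simp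
      have hv0 : 0 ≤ 1 + P / 2 * ‖W‖⁻¹ := by positivity
      -- the two terms
      have hT1 : ‖(fderiv ℝ (fderiv ℝ Λ) (t, W, ρ) ((1 : ℝ), (0 : Fin 2 → ℂ), ε₁ t * (2 * ρ)⁻¹)) ((1 : ℝ), (0 : Fin 2 → ℂ), ε₁ t * (2 * ρ)⁻¹)‖ ≤
          A * (1 + P / 2 * ‖W‖⁻¹) ^ 2 := by
        calc _ ≤ ‖fderiv ℝ (fderiv ℝ Λ) (t, W, ρ) ((1 : ℝ), (0 : Fin 2 → ℂ), ε₁ t * (2 * ρ)⁻¹)‖ * ‖((1 : ℝ), (0 : Fin 2 → ℂ), ε₁ t * (2 * ρ)⁻¹)‖ :=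
              ContinuousLinearMap.le_opNorm _ _
          _ ≤ (‖fderiv ℝ (fderiv ℝ Λ) (t, W, ρ)‖ * ‖((1 : ℝ), (0 : Fin 2 → ℂ), ε₁ t * (2 * ρ)⁻¹)‖) * ‖((1 : ℝ), (0 : Fin 2 → ℂ), ε₁ t * (2 * ρ)⁻¹)‖ := by
              gcongr; exact ContinuousLinearMap.le_opNorm _ _
          _ ≤ (A * (1 + P / 2 * ‖W‖⁻¹)) * (1 + P / 2 * ‖W‖⁻¹) := by gcongr
          _ = A * (1 + P / 2 * ‖W‖⁻¹) ^ 2 := by ring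
      have hT2 : ‖(fderiv ℝ Λ (t, W, ρ)) ((0 : ℝ), (0 : Fin 2 → ℂ), ε₂ t * (2 * ρ)⁻¹ - ε₁ t ^ 2 * (4 * ρ ^ 3)⁻¹)‖ ≤
          B * (Q / 2 * ‖W‖⁻¹ + P ^ 2 / 4 * (‖W‖ ^ 3)⁻¹) :=
        (ContinuousLinearMap.le_opNorm _ _).trans (by gcongr)
      -- expand `(1 + P∕2·‖W‖⁻¹)² = 1 + P‖W‖⁻¹ + P²∕4·‖W‖⁻²` and dominate every power by `‖W‖⁻³`
      have hsq : (1 + P / 2 * ‖W‖⁻¹) ^ 2 = 1 + P * ‖W‖⁻¹ + P ^ 2 / 4 * (‖W‖ ^ 2)⁻¹ := by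
        field_simp
        ring
      calc _ ≤ A * (1 + P / 2 * ‖W‖⁻¹) ^ 2 + B * (Q / 2 * ‖W‖⁻¹ + P ^ 2 / 4 * (‖W‖ ^ 3)⁻¹) := (norm_add_le _ _).trans (add_le_add hT1 hT2)
        _ = A * (1 + P * ‖W‖⁻¹ + P ^ 2 / 4 * (‖W‖ ^ 2)⁻¹) + B * (Q / 2 * ‖W‖⁻¹ + P ^ 2 / 4 * (‖W‖ ^ 3)⁻¹) := by rw [hsq]
        _ ≤ A * (Real.sqrt S ^ 3 * (‖W‖ ^ 3)⁻¹ + P * (Real.sqrt S ^ 2 * (‖W‖ ^ 3)⁻¹) + P ^ 2 / 4 * (Real.sqrt S * (‖W‖ ^ 3)⁻¹)) +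
              B * (Q / 2 * (Real.sqrt S ^ 2 * (‖W‖ ^ 3)⁻¹) + P ^ 2 / 4 * (‖W‖ ^ 3)⁻¹) := by gcongr
        _ = (A * (Real.sqrt S ^ 3 + P * Real.sqrt S ^ 2 + P ^ 2 / 4 * Real.sqrt S) + B * (Q / 2 * Real.sqrt S ^ 2 + P ^ 2 / 4)) * (‖W‖ ^ 3)⁻¹ := by ring
  · rw [indicator_of_notMem hW]
    simp only [mem_setOf_eq, not_le] at hW
    have hr : S < Real.sqrt (ε t + nsq W) ^ 2 := by
      rw [Real.sq_sqrt (by linarith [nsq_nonneg W])]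
      linarith
    rw [fderiv_eq_zero_of_lt_sq hS t W hr, fderiv_fderiv_eq_zero_of_lt_sq hS t W hr, _root_.zero_apply,
      _root_.zero_apply, _root_.zero_apply, add_zero, norm_zero]

/-! ### §4 Pointwise calculus along the curve `t ↦ γ(t) = (t, W, √(ε(t) + |W|²))` -/

/-- The sheet radius `t ↦ √(ε(t) + |W|²)` has derivative `ε′(t)·(2ρ)⁻¹` where `ε(t) + |W|² > 0`. [cite: Rudin1980, §1.4] -/
theorem hasDerivAt_sqrt_eps_add_nsq (hε : ∀ t, HasDerivAt ε (ε₁ t) t) (W : Fin 2 → ℂ) {t : ℝ} (h : 0 < ε t + nsq W) :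
    HasDerivAt (fun t : ℝ => Real.sqrt (ε t + nsq W)) (ε₁ t * (2 * Real.sqrt (ε t + nsq W))⁻¹) t := by
  have h1 := ((hε t).add_const (nsq W)).sqrt h.ne'
  refine h1.congr_deriv ?_
  rw [div_eq_mul_inv]

/-- The curve `γ(t) = (t, W, ρ(t))` has velocity `γ′ = (1, 0, ε′(2ρ)⁻¹)`. [cite: Rudin1980, §1.4] -/
theorem hasDerivAt_curve (hε : ∀ t, HasDerivAt ε (ε₁ t) t) (W : Fin 2 → ℂ) {t : ℝ} (h : 0 < ε t + nsq W) :
    HasDerivAt (fun t : ℝ => ((t, W, Real.sqrt (ε t + nsq W)) : ℝ × (Fin 2 → ℂ) × ℝ))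
      ((1 : ℝ), (0 : Fin 2 → ℂ), ε₁ t * (2 * Real.sqrt (ε t + nsq W))⁻¹) t :=
  (hasDerivAt_id t).prodMk ((hasDerivAt_const t W).prodMk (hasDerivAt_sqrt_eps_add_nsq hε W h))

/-- The velocity `t ↦ γ′(t)` has derivative `γ″ = (0, 0, ε″(2ρ)⁻¹ − ε′²(4ρ³)⁻¹)`. [cite: Rudin1980, §1.4] -/
theorem hasDerivAt_velocity (hε : ∀ t, HasDerivAt ε (ε₁ t) t) (hε' : ∀ t, HasDerivAt ε₁ (ε₂ t) t) (W : Fin 2 → ℂ) {t : ℝ} (h : 0 < ε t + nsq W) :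
    HasDerivAt (fun t : ℝ => (((1 : ℝ), (0 : Fin 2 → ℂ), ε₁ t * (2 * Real.sqrt (ε t + nsq W))⁻¹) : ℝ × (Fin 2 → ℂ) × ℝ))
      ((0 : ℝ), (0 : Fin 2 → ℂ), ε₂ t * (2 * Real.sqrt (ε t + nsq W))⁻¹ - ε₁ t ^ 2 * (4 * Real.sqrt (ε t + nsq W) ^ 3)⁻¹) t := by
  have hρ : 0 < Real.sqrt (ε t + nsq W) := Real.sqrt_pos.2 h
  have hρne : Real.sqrt (ε t + nsq W) ≠ 0 := hρ.ne'
  have hinv : HasDerivAt (fun t : ℝ => (2 * Real.sqrt (ε t + nsq W))⁻¹)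
      (-(2 * (ε₁ t * (2 * Real.sqrt (ε t + nsq W))⁻¹)) / (2 * Real.sqrt (ε t + nsq W)) ^ 2) t :=
    ((hasDerivAt_sqrt_eps_add_nsq hε W h).const_mul 2).inv (by positivity)
  have h3 := (hε' t).mul hinv
  have h3' : HasDerivAt (fun t : ℝ => ε₁ t * (2 * Real.sqrt (ε t + nsq W))⁻¹)
      (ε₂ t * (2 * Real.sqrt (ε t + nsq W))⁻¹ - ε₁ t ^ 2 * (4 * Real.sqrt (ε t + nsq W) ^ 3)⁻¹) t := by
    refine h3.congr_deriv ?_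
    field_simp
    ring
  exact (hasDerivAt_const t (1 : ℝ)).prodMk ((hasDerivAt_const t (0 : Fin 2 → ℂ)).prodMk h3')

/-- **FIRST `t`-DERIVATIVE OF THE INTEGRAND**: `∂_t Λ(γ(t)) = DΛ(γ)[γ′]` for `Λ` of class `C¹`. [cite: Rudin1980, §1.4] -/
theorem hasDerivAt_comp_curve (hΛ : ContDiff ℝ 2 Λ) (hε : ∀ t, HasDerivAt ε (ε₁ t) t) (W : Fin 2 → ℂ) {t : ℝ} (h : 0 < ε t + nsq W) :
    HasDerivAt (fun t : ℝ => Λ (t, W, Real.sqrt (ε t + nsq W)))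
      ((fderiv ℝ Λ (t, W, Real.sqrt (ε t + nsq W))) ((1 : ℝ), (0 : Fin 2 → ℂ), ε₁ t * (2 * Real.sqrt (ε t + nsq W))⁻¹)) t :=
  ((hΛ.differentiable two_ne_zero).differentiableAt.hasFDerivAt).comp_hasDerivAt t (hasDerivAt_curve hε W h)

/-- **SECOND `t`-DERIVATIVE OF THE INTEGRAND**: `∂_t DΛ(γ)[γ′] = D²Λ(γ)[γ′,γ′] + DΛ(γ)[γ″]` for `Λ` of class `C²`. [cite: Rudin1980, §1.4] -/
theorem hasDerivAt_fderiv_comp_curve (hΛ : ContDiff ℝ 2 Λ) (hε : ∀ t, HasDerivAt ε (ε₁ t) t) (hε' : ∀ t, HasDerivAt ε₁ (ε₂ t) t)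
    (W : Fin 2 → ℂ) {t : ℝ} (h : 0 < ε t + nsq W) :
    HasDerivAt (fun t : ℝ => (fderiv ℝ Λ (t, W, Real.sqrt (ε t + nsq W))) ((1 : ℝ), (0 : Fin 2 → ℂ), ε₁ t * (2 * Real.sqrt (ε t + nsq W))⁻¹))
      ((fderiv ℝ (fderiv ℝ Λ) (t, W, Real.sqrt (ε t + nsq W)) ((1 : ℝ), (0 : Fin 2 → ℂ), ε₁ t * (2 * Real.sqrt (ε t + nsq W))⁻¹))
          ((1 : ℝ), (0 : Fin 2 → ℂ), ε₁ t * (2 * Real.sqrt (ε t + nsq W))⁻¹) +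
        (fderiv ℝ Λ (t, W, Real.sqrt (ε t + nsq W)))
          ((0 : ℝ), (0 : Fin 2 → ℂ), ε₂ t * (2 * Real.sqrt (ε t + nsq W))⁻¹ - ε₁ t ^ 2 * (4 * Real.sqrt (ε t + nsq W) ^ 3)⁻¹)) t := by
  -- NB: `h1` unascribed
  have h1 := hΛ.fderiv_right (m := 1) le_rfl
  have hc := ((h1.differentiable one_ne_zero).differentiableAt.hasFDerivAt).comp_hasDerivAt t (hasDerivAt_curve hε W h)
  exact hc.clm_apply (hasDerivAt_velocity hε hε' W h)

end EngineT

end Literature.Geometry.ComplexHyperbolic.BallModel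

end
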